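import Summits.BirchSwinnertonDyer.Rank1Residual.GaloisImage.KatoKuriharaValueOfComparison
import Summits.BirchSwinnertonDyer.Rank1Residual.GaloisImage.CyclotomicTameLevelArithmetic
import Summits.BirchSwinnertonDyer.Rank1Residual.GaloisImage.CyclotomicUnitsCRTCoordinates
import Summits.BirchSwinnertonDyer.Rank1Residual.GaloisImage.KolyvaginDerivativeTaylorCoefficient
import Summits.BirchSwinnertonDyer.Rank1Residual.GaloisImage.CyclotomicLevelInertiaGenerators
import Literature.NumberTheory.GaloisRepresentations.DecompositionGroupOfCompletion
import Literature.NumberTheory.GaloisCohomology.FiniteSingularComparison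
import HarnessLib

/-!
# THE VALUE ROW at a tame level `(σ, r)` FROM THE COMPARISON: PK-6₂'s displayed `hvalk` / `hvalm`
# (T-PK62-PAIR) assembled from PK-4b-C4b-2's membership statement, PK-3 and T-PK6-VAL FILES 1–3
# (cell `b2b-bsdres`, team n1011, ROUTE-1 PORT anatomy (P-KIM); ROW T-PK6-VROW, seat p02 GEN 14)

HONEST FRAMING (cell `b2b-bsdres`, run/shared/lean/b2b/bsd-rank1-residual/, verbatim in every
file): the goal of the cell is to DELETE the COMBINATION-SHAPED residual classes of the
Birch–Swinnerton-Dyer formula for ALL analytic-rank `≤ 1` elliptic curves over `ℚ` — "full BSD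
formula for every rank `≤ 1` curve in class `C`" assembled STRICTLY from published theorems — so
that the rank-`≤ 1` remainder becomes exactly the CONSTRUCTION-SHAPED classes, which are TYPED
(missing-input `Prop`s), NOT attempted. This is not "finishing BSD". Team n1011 (N10/N11; ROUTE 1,
the PORT anatomy (P-KIM) of class X4 ∧ `p = 3`): research route on CONSTRUCTION-SHAPED classes;
prove what is provable now; no claim beyond stated classes; census output = EVIDENCE, never a
Literature fact; RESIDUAL-MAP marks UNCHANGED; nothing is booked by this file. TOOL THEOREMS ONLY:
no definition, no named fact, no instance, no `sorry`.

## What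

THEOREM D hands the PORT's discharger ★ PK-6₂ (p13, `KatoValue.exists_katoKuriharaWitnessAt_pair_of_zetaBody`)
generators `σ_q ∈ I_q ≤ Γ_ℚ` with prescribed cyclotomic characters `χ_{N𝔮}(σ_q) = η_q`, `η_q` a
primitive root mod `ℓ_q` (`KolyvaginDatum.HasCanonicalComparison`), and asks, for every level `r ⊆ 𝒫`
of usable Kolyvagin primes, for the VALUE ROW
`∃ s u ψ, (∀ q ∈ r, ψ_{ℓ_q} onto) ∧ [p^t • (1 ⊗ 𝔇^{field}_r(x_{0,r} + σ₋₁ x_{0,r})) − s ⊗ 1 ∈ p^{k+1} L_int]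
        ∧ s̄ = u · p^t · δ̃_{n(r)}(ψ)`                                                         (hvalk)
(`δ̃ = kuriharaNumber f (p^{k+1}) (∏_{q∈r} N𝔮) ψ`, Kurihara's number of the Mazur–Tate element).  This
file PRODUCES (hvalk) — token for token, in PK-6₂'s currency — from ONE displayed hypothesis: the
group-ring COMPARISON in membership form (PK-4b-C3/C4b-2's OUT = T-PK6-VAL FILE 1's socket `hmem`)
`∏_q D_q · (n • (1 + δ₋₁)·X − (Θ₀·V)^ℚ) ∈ image of p^{k+1} ℤ_p[(ℤ/n)ˣ]`
for the avatar `X` of `x_{0,r}` (`hxX`, T-PKEV E-D), the `p`-integral structure `Θ₀` of the Mazur–Tate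
element `θ̃_f(n)` (`hΘ`, PK-3's binder verbatim) and an integral twist `V` with unit augmentation `Σ_g V_g ∈ ℤ_pˣ` (`hV`).
Everything else is COMPOSITION BY NAME: `n(r) = ∏ ℓ_q` is a square-free Kolyvagin product (T-PK6-VAL
FILE 2 + `hKol`); the surjective logarithms `ψ_q = log_{η_q}` (FILE 3 §3); PK-3's three generator
hypotheses for `b_q = χ_n(σ_q)` (FILE 3 ★ `UnitsCRT.generator_hypotheses_of_equiv`: `hoff` because
`σ_q ∈ I_q` fixes `μ_{ℓ_{q'}}`, `CyclotomicLevel.Rat.mem_rootsOfUnityFixer_of_mem_inertia` + `unitsMap_modNCyclotomicCharacter_of_dvd`; `hcyc` from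
`χ(σ_q) = η_q` generating); PK-3 `MazurTateDerivative.mapRingHom_padicLift_mul_prod_deriv_eq_kuriharaNumber_smul`
(Kim–Nakamura Prop. 3.5: `Θ̄₀·∏D = (−1)^ν δ̃ · ∏Nrm`) reindexed by the places (FILE 1
`prod_sum_fin_single_pow_eq_of_equiv`) and twisted by `V` (FILE 1 ★ `mapRingHom_mul_mul_prod_deriv_eq_smul`);
`∏Nrm = Σ_g δ_g` (T-PKEV E-A); FILE 1 ★ `GroupRingEval.exists_witness_hval_and_toZModPow_eq`
(`s = p^t·u⁻¹·c̃·μ(n)`); and the level transport `n(r) = ∏_{q∈r} N𝔮` for `kuriharaNumber` / `ψ`.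
§3 discharges the binder `∃ Θ₀, hΘ` (`p`-integrality of `[a/n]⁺_f` for `E[p]` irreducible, `p` odd,
`gcd(n, N) = 1`: `exists_padicLift_modularElement` + `IsNewformOf.norm_ratPlusSymbol_div_le_one`,
`IsKolyvaginPrime.not_dvd_conductorNorm`).  HONEST LIMITS: the comparison `hmem`, `hxX` and `hV` are
HYPOTHESES (C4b-2 / the wrapper's certificates); nothing about `ZetaBody`, Kolyvagin systems, `exp*`
or classes is used or proved; closes nothing; books nothing; 0 defs / 0 facts.

References: C.-H. Kim, AJM 148 (2026) = arXiv:2203.12159 v3, §2.2.2, §3.4.1–§3.5 and the proof of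
Thm. 3.13 (pp. 26–28) [Kim2022StructureSelmer]; C.-H. Kim, K. Nakamura, JNT 210 (2020) =
arXiv:1808.07726 v2, Prop. 3.5, Rem. 3.6 (pp. 8–9) [KimNakamura2020]; M. Kurihara, arXiv:1407.2465
§1.1 [Kurihara2014]; K. Rubin, *Euler Systems* (2000) §4.4 [Rubin2000]; design `cells/n1011/ROUTE-1.md`
§58 D-58-1 (r1), T-PK62-PAIR names line (p13 GEN 14, cell INBOX 2026-08-22T10:59Z),
`HOME/b2b-bsdres-n1011-p15/g9/pk4/PK4b-C4-DESIGN.md` (p15).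
-/

noncomputable section

open scoped BigOperators NumberField TensorProduct
open Finset IsDedekindDomain NumberField Field WeierstrassCurve Rat.HeightOneSpectrum
open Literature.NumberTheory.GaloisRepresentations Literature.NumberTheory.GaloisCohomology
open Literature.NumberTheory.LFunctions (absNorm_asIdeal_eq_primesEquiv)
open Literature.NumberTheory.EllipticCurves Literature.NumberTheory.EllipticCurves.ModularForms
open Literature.NumberTheory.EllipticCurves.Kato2004.EulerSystemValues

namespace Summit.BirchSwinnertonDyer.Rank1Residual.GaloisImage.ValueRow

variable (p : ℕ) [Fact p.Prime]

/-! ### §1 Small-level plumbing: `n(r) = ∏ N𝔮`, generators and logarithms along an equality of moduli -/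

omit [Fact p.Prime] in
/-- **`n(r) = ∏_{q ∈ r} N𝔮`**: the tame level of T-PK6-VAL FILE 2 (`cycLevel p 0 r = ∏ ℓ_q`) in the
`Ideal.absNorm` currency of PK-6₂'s `kuriharaNumber` clause. [folklore] -/
theorem cycLevel_zero_eq_prod_absNorm (r : Finset (HeightOneSpectrum (𝓞 ℚ))) :
    cycLevel p 0 r = ∏ q ∈ r, Ideal.absNorm q.asIdeal := by
  rw [TameLevel.cycLevel_zero_eq_prod]
  exact Finset.prod_congr rfl fun q _ => (absNorm_asIdeal_eq_primesEquiv q).symm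

/-- `kuriharaNumber` only depends on the level through its value (the `NeZero` instance is a
proposition): transport along an equality of levels. [folklore] -/
theorem kuriharaNumber_congr {N₀ : ℕ} [NeZero N₀] (f : CuspForm (CongruenceSubgroup.Gamma0 N₀) 2)
    (m : ℕ) {n n' : ℕ} [NeZero n] [NeZero n'] (h : n = n')
    (ψ : (ℓ : ℕ) → (ZMod ℓ)ˣ →* Multiplicative (ZMod m)) :
    kuriharaNumber f m n ψ = kuriharaNumber f m n' ψ := by
  subst h
  rfl

/-- A generator of `(ℤ/N')ˣ` maps to a generator of `(ℤ/N)ˣ` along `N = N'`. [folklore] -/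
theorem forall_mem_zpowers_unitsMap_of_eq {N N' : ℕ} [NeZero N'] (h : N = N') (η : (ZMod N')ˣ)
    (hη : Subgroup.zpowers η = ⊤) (y : (ZMod N)ˣ) :
    y ∈ Subgroup.zpowers (ZMod.unitsMap (dvd_of_eq h) η) := by
  obtain ⟨y', rfl⟩ := ZMod.unitsMap_surjective (dvd_of_eq h) y
  have hy' : y' ∈ Subgroup.zpowers η := by rw [hη]; exact Subgroup.mem_top y'
  obtain ⟨z, rfl⟩ := Subgroup.mem_zpowers_iff.1 hy'
  exact Subgroup.mem_zpowers_iff.2 ⟨z, by rw [map_zpow]⟩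

/-- **The family of surjective logarithms normalised at THEOREM D's primitive roots**, indexed by ALL
naturals (PK-3's / DICT3's `ψ : (ℓ : ℕ) → (ℤ/ℓ)ˣ →* ℤ/m`): at `ℓ = N𝔮`, `q ∈ r`, `ψ_ℓ` is onto and
`ψ_ℓ(η_q) = 1` (T-PK6-VAL FILE 3 `UnitsCRT.exists_surjective_unitsHom_apply_eq_one`, `m ∣ N𝔮 − 1`).
[cite: KimNakamura2020, Rem. 3.6 (arXiv v2 p. 9)] -/
theorem exists_family_surjective_normalised (m : ℕ) (r : Finset (HeightOneSpectrum (𝓞 ℚ)))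
    (η : (q : HeightOneSpectrum (𝓞 ℚ)) → (ZMod (Ideal.absNorm q.asIdeal))ˣ)
    (hη : ∀ q ∈ r, Subgroup.zpowers (η q) = ⊤)
    (hm : ∀ q ∈ r, m ∣ Ideal.absNorm q.asIdeal - 1) :
    ∃ ψ : (ℓ : ℕ) → (ZMod ℓ)ˣ →* Multiplicative (ZMod m),
      ∀ (ℓ : ℕ), ∀ q ∈ r, ∀ h : ℓ = Ideal.absNorm q.asIdeal,
        Function.Surjective (ψ ℓ) ∧
          Multiplicative.toAdd (ψ ℓ (ZMod.unitsMap (dvd_of_eq h) (η q))) = 1 := by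
  classical
  have key : ∀ ℓ : ℕ, ∃ ψ : (ZMod ℓ)ˣ →* Multiplicative (ZMod m),
      ∀ q ∈ r, ∀ h : ℓ = Ideal.absNorm q.asIdeal,
        Function.Surjective ψ ∧ Multiplicative.toAdd (ψ (ZMod.unitsMap (dvd_of_eq h) (η q))) = 1 := by
    intro ℓ
    by_cases hℓ : ∃ q ∈ r, ℓ = Ideal.absNorm q.asIdeal
    · obtain ⟨q₀, hq₀, rfl⟩ := hℓ
      have hprime : (Ideal.absNorm q₀.asIdeal).Prime := by
        rw [absNorm_asIdeal_eq_primesEquiv]; exact (primesEquiv q₀).2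
      obtain ⟨ψ, hsurj, hone⟩ := UnitsCRT.exists_surjective_unitsHom_apply_eq_one hprime (hm q₀ hq₀)
        (η q₀) (fun y => by rw [hη q₀ hq₀]; exact Subgroup.mem_top y)
      refine ⟨ψ, fun q hq h => ⟨hsurj, ?_⟩⟩
      -- `N𝔮₀ = N𝔮` forces `q = q₀`
      have hqq : q = q₀ := by
        rw [absNorm_asIdeal_eq_primesEquiv, absNorm_asIdeal_eq_primesEquiv] at h
        exact primesEquiv.injective (Subtype.ext h.symm)
      subst hqq
      rw [show ZMod.unitsMap (dvd_of_eq h) = MonoidHom.id _ from ZMod.unitsMap_self _,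
        MonoidHom.id_apply, hone]
    · exact ⟨1, fun q hq h => absurd ⟨q, hq, h⟩ hℓ⟩
  choose ψ hψ using key
  exact ⟨ψ, hψ⟩

/-- **THEOREM D's generators are off-diagonally trivial on the tame level**: `σ_q ∈ I_{𝔔_q}` fixes the
roots of unity of order prime to `ℓ_q`, so for every prime `ℓ' ∣ n(r)`, `ℓ' ≠ ℓ_q`:
`χ_{n(r)}(σ_q) mod ℓ' = χ_{ℓ'}(σ_q) = 1` (`CyclotomicLevel.Rat.mem_rootsOfUnityFixer_of_mem_inertia` +
`unitsMap_modNCyclotomicCharacter_of_dvd`) — T-PK6-VAL FILE 3's `hoff` / PK-4b-C4b-2 (v)'s displayed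
`hb` for `b_q := χ_{n(r)}(σ_q)`, `q` ANY place (in `r` or not). [cite: Rubin2000, §4.4 (the choice of `σ_ℓ`)] -/
theorem unitsMap_modNCyclotomicCharacter_eq_one_of_mem_inertia
    (σ : HeightOneSpectrum (𝓞 ℚ) → absoluteGaloisGroup ℚ)
    (hσI : ∀ q, σ q ∈ (adicCompletionPrime ℚ q).inertia (absoluteGaloisGroup ℚ))
    (r : Finset (HeightOneSpectrum (𝓞 ℚ))) (q : HeightOneSpectrum (𝓞 ℚ)) {ℓ' : ℕ}
    (hℓ' : ℓ' ∈ (cycLevel p 0 r).primeFactors) (hne : ℓ' ≠ ((primesEquiv q : Nat.Primes) : ℕ)) :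
    ZMod.unitsMap (Nat.dvd_of_mem_primeFactors hℓ')
      (modNCyclotomicCharacter ℚ (cycLevel p 0 r) (σ q)) = 1 := by
  haveI : NeZero ℓ' := ⟨(Nat.prime_of_mem_primeFactors hℓ').ne_zero⟩
  rw [unitsMap_modNCyclotomicCharacter_of_dvd ℚ (Nat.dvd_of_mem_primeFactors hℓ') (σ q)]
  have hfix : σ q ∈ rootsOfUnityFixer ℚ ℓ' := by
    refine CyclotomicLevel.Rat.mem_rootsOfUnityFixer_of_mem_inertia q
      (adicCompletionPrime_mem_primesAbove ℚ q) (hσI q) fun hdvd => hne ?_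
    exact ((Nat.prime_dvd_prime_iff_eq (primesEquiv q).2 (Nat.prime_of_mem_primeFactors hℓ')).1 hdvd).symm
  rw [rootsOfUnityFixer_eq_ker, MonoidHom.mem_ker] at hfix
  exact hfix

/-! ### §2 ★★ The value row from the comparison -/

variable {W : WeierstrassCurve ℚ} [W.IsElliptic] [W.IsGloballyMinimal]
variable {N₀ : ℕ} [NeZero N₀] (f : CuspForm (CongruenceSubgroup.Gamma0 N₀) 2)

set_option backward.isDefEq.respectTransparency false in
/-- **★★ THE VALUE ROW AT `(σ, r)` FROM THE COMPARISON** (PK-6₂'s `hvalk` / `hvalm`, T-PK62-PAIR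
`KatoValue.exists_katoKuriharaWitnessAt_pair_of_zetaBody`, token for token at `f := P.f`, `p := 3`,
`xr := x 0 ⟨r, _⟩`).  Data: `p` odd, `f` the newform of `E = W` with `E[p]` irreducible; THEOREM D's
generators `σ_q ∈ I_{𝔔_q}` (`hσI`) with `χ_{N𝔮}(σ_q) = η_q` (`hσχ`), `η_q` primitive roots on `r` (`hη` —
`KolyvaginDatum.HasCanonicalComparison.zpowers_eq_top`), `r` a set of Kolyvagin primes of level `k + 1`
(`hKol`); the value `xr ∈ ℚ(ζ_n)`, `n = n(r) = cycLevel p 0 r`, with avatar `X` (`hxX`, T-PKEV E-D); the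
`p`-integral structure `Θ₀` of `θ̃_f(n)` (`hΘ`, PK-3's binder); an integral twist `V` with unit
augmentation `Σ_g V_g ∈ ℤ_pˣ` (`hV`); and THE COMPARISON `hmem` — PK-4b-C's OUT in T-PK6-VAL FILE 1's
membership currency for `X⁺ = n • (1 + δ₋₁)·X` and `Θ = Θ₀·V`.  Conclusion: the value row
`∃ s u ψ, (∀ q ∈ r, ψ_{N𝔮} onto) ∧ hval(s) ∧ s̄ = u · p^t · kuriharaNumber f (p^{k+1}) (∏_{q∈r} N𝔮) ψ`.
[cite: Kim2022StructureSelmer, §3.4.1–§3.5 and the proof of Thm. 3.13 (arXiv v3 pp. 26–28; = Thm. 3.11 of AJM 148)]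
[cite: KimNakamura2020, Prop. 3.5 and Rem. 3.6 (arXiv v2 pp. 8–9)] -/
theorem exists_valueRow_of_mem_map_span (hp2 : p ≠ 2) (hf : IsNewformOf W f)
    (hirr : W.HasIrreducibleModPGaloisRep p) (k t : ℕ)
    (σ : HeightOneSpectrum (𝓞 ℚ) → absoluteGaloisGroup ℚ)
    (η : (q : HeightOneSpectrum (𝓞 ℚ)) → (ZMod (Ideal.absNorm q.asIdeal))ˣ)
    (hσI : ∀ q, σ q ∈ (adicCompletionPrime ℚ q).inertia (absoluteGaloisGroup ℚ))
    (hσχ : ∀ q, modNCyclotomicCharacter ℚ (Ideal.absNorm q.asIdeal) (σ q) = η q)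
    (r : Finset (HeightOneSpectrum (𝓞 ℚ)))
    (hη : ∀ q ∈ r, Subgroup.zpowers (η q) = ⊤)
    (hKol : ∀ q ∈ r, Kato.IsKolyvaginPrime W p (k + 1) ((primesEquiv q : Nat.Primes) : ℕ))
    (xr : CyclotomicField (cycLevel p 0 r) ℚ) (X : MonoidAlgebra ℚ (ZMod (cycLevel p 0 r))ˣ)
    (hxX : xr = ∑ g : (ZMod (cycLevel p 0 r))ˣ, X.coeff g •
      sigma (cycLevel p 0 r) g (IsCyclotomicExtension.zeta (cycLevel p 0 r) ℚ
        (CyclotomicField (cycLevel p 0 r) ℚ)))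
    (Θ₀ : MonoidAlgebra ℤ_[p] (ZMod (cycLevel p 0 r))ˣ)
    (hΘ : ∀ a : (ZMod (cycLevel p 0 r))ˣ, ((Θ₀.coeff a : ℤ_[p]) : ℚ_[p]) =
      ((ratPlusSymbol f ((((a : ZMod (cycLevel p 0 r))).val : ℚ) / (cycLevel p 0 r)) : ℚ) : ℚ_[p]))
    (V : MonoidAlgebra ℤ_[p] (ZMod (cycLevel p 0 r))ˣ)
    (hV : IsUnit (∑ g : (ZMod (cycLevel p 0 r))ˣ, V.coeff g))
    (hmem : (∏ q ∈ r, ∑ j : Fin (((primesEquiv q : Nat.Primes) : ℕ) - 1),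
          MonoidAlgebra.single (modNCyclotomicCharacter ℚ (cycLevel p 0 r) (σ q) ^ (j : ℕ))
            ((j : ℕ) : ℚ_[p])) *
        (MonoidAlgebra.mapRingHom (ZMod (cycLevel p 0 r))ˣ (algebraMap ℚ ℚ_[p])
            (((cycLevel p 0 r : ℕ) : ℚ) •
              ((1 + MonoidAlgebra.single (-1 : (ZMod (cycLevel p 0 r))ˣ) (1 : ℚ)) * X)) -
          MonoidAlgebra.mapRingHom (ZMod (cycLevel p 0 r))ˣ (PadicInt.Coe.ringHom (p := p)) (Θ₀ * V)) ∈
      (Ideal.span {((p : MonoidAlgebra ℤ_[p] (ZMod (cycLevel p 0 r))ˣ)) ^ (k + 1)}).toAddSubmonoid.map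
        (MonoidAlgebra.mapRingHom (ZMod (cycLevel p 0 r))ˣ (PadicInt.Coe.ringHom (p := p)) :
          MonoidAlgebra ℤ_[p] (ZMod (cycLevel p 0 r))ˣ →+ MonoidAlgebra ℚ_[p] (ZMod (cycLevel p 0 r))ˣ)) :
    ∃ (s : ℤ_[p]) (u : (ZMod (p ^ (k + 1)))ˣ)
      (ψ : (ℓ : ℕ) → (ZMod ℓ)ˣ →* Multiplicative (ZMod (p ^ (k + 1)))),
      (∀ q ∈ r, Function.Surjective (ψ (Ideal.absNorm q.asIdeal))) ∧
      (∃ l ∈ cycIntLattice p (cycLevel p 0 r),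
        ((p : ℤ_[p]) ^ t) • ((1 : ℚ_[p]) ⊗ₜ[ℚ]
          ((r.noncommProd (fun ℓ : HeightOneSpectrum (𝓞 ℚ) =>
              ∑ j ∈ Finset.range (((primesEquiv ℓ : Nat.Primes) : ℕ) - 1),
                (j : Module.End ℚ (CyclotomicField (cycLevel p 0 r) ℚ)) *
                  (sigma (cycLevel p 0 r) (modNCyclotomicCharacter ℚ (cycLevel p 0 r) (σ ℓ)) :
                    CyclotomicField (cycLevel p 0 r) ℚ →ₐ[ℚ]
                      CyclotomicField (cycLevel p 0 r) ℚ).toLinearMap ^ j)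
            (ZetaValue.pairwise_commute_fieldDeriv (cycLevel p 0 r)
              (fun ℓ => modNCyclotomicCharacter ℚ (cycLevel p 0 r) (σ ℓ))
              (fun ℓ => ((primesEquiv ℓ : Nat.Primes) : ℕ) - 1) r))
            (xr + sigma (cycLevel p 0 r) (-1) xr))) -
          ((s : ℚ_[p]) ⊗ₜ[ℚ] (1 : CyclotomicField (cycLevel p 0 r) ℚ)) =
        ((p : ℤ_[p]) ^ (k + 1)) • (l : ℚ_[p] ⊗[ℚ] CyclotomicField (cycLevel p 0 r) ℚ)) ∧
      haveI : NeZero (∏ q ∈ r, Ideal.absNorm q.asIdeal) :=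
        ⟨Finset.prod_ne_zero_iff.2 fun q _ h => q.ne_bot (Ideal.absNorm_eq_zero_iff.1 h)⟩
      PadicInt.toZModPow (k + 1) s = (u : ZMod (p ^ (k + 1))) *
        ((p : ℕ) : ZMod (p ^ (k + 1))) ^ t *
          kuriharaNumber f (p ^ (k + 1)) (∏ q ∈ r, Ideal.absNorm q.asIdeal) ψ := by
  classical
  haveI : NeZero (p ^ (k + 1)) := ⟨pow_ne_zero _ (Fact.out : p.Prime).ne_zero⟩
  -- ### the level `n = n(r)`: square-free Kolyvagin product, prime to `p`, reindexed by the places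
  have hsf : Squarefree (cycLevel p 0 r) := TameLevel.squarefree_cycLevel_zero p r
  have hrp : ∀ q ∈ r, ((primesEquiv q : Nat.Primes) : ℕ) ≠ p := fun q hq => (hKol q hq).ne
  have hKP : Kato.IsKolyvaginProduct W p (k + 1) (cycLevel p 0 r) := by
    refine ⟨hsf, fun ℓ hℓ => ?_⟩
    rw [TameLevel.primeFactors_cycLevel_zero, Finset.mem_image] at hℓ
    obtain ⟨q, hq, rfl⟩ := hℓ
    exact hKol q hq
  obtain ⟨e, he⟩ := TameLevel.exists_equiv_primeFactors_cycLevel_zero p r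
  have hne : ∀ q : r, NeZero (((e q : (cycLevel p 0 r).primeFactors) : ℕ)) := fun q =>
    ⟨(Nat.prime_of_mem_primeFactors (e q).2).ne_zero⟩
  -- `(e q : ℕ) = ℓ_q = N𝔮`
  have heN : ∀ q : r, (((e q : (cycLevel p 0 r).primeFactors) : ℕ)) =
      Ideal.absNorm (q : HeightOneSpectrum (𝓞 ℚ)).asIdeal := fun q => by
    rw [he q, absNorm_asIdeal_eq_primesEquiv]
  -- ### the logarithms `ψ`, normalised at THEOREM D's `η`
  have hm : ∀ q ∈ r, p ^ (k + 1) ∣ Ideal.absNorm q.asIdeal - 1 := fun q hq => by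
    rw [absNorm_asIdeal_eq_primesEquiv]
    exact (Nat.modEq_iff_dvd' (hKol q hq).prime.one_lt.le).1 (hKol q hq).modEq_one.symm
  obtain ⟨ψ, hψ⟩ := exists_family_surjective_normalised (p ^ (k + 1)) r η hη hm
  -- ### PK-3's generator hypotheses for `b_q = χ_n(σ_q)` (T-PK6-VAL FILE 3 ★)
  have hoff : ∀ q q' : r, q ≠ q' →
      ZMod.unitsMap (Nat.dvd_of_mem_primeFactors (e q').2)
        (modNCyclotomicCharacter ℚ (cycLevel p 0 r) (σ q)) = 1 := fun q q' hqq' =>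
    unitsMap_modNCyclotomicCharacter_eq_one_of_mem_inertia p σ hσI r q (e q').2 fun h =>
      hqq' (Subtype.ext (primesEquiv.injective (Subtype.ext ((he q').symm.trans h).symm)))
  have hcyc : ∀ q : r, ∀ y : (ZMod (((e q : (cycLevel p 0 r).primeFactors) : ℕ)))ˣ,
      y ∈ Subgroup.zpowers (ZMod.unitsMap (Nat.dvd_of_mem_primeFactors (e q).2)
        (modNCyclotomicCharacter ℚ (cycLevel p 0 r) (σ q))) := by
    intro q y
    haveI := hne q
    rw [unitsMap_modNCyclotomicCharacter_of_dvd ℚ (Nat.dvd_of_mem_primeFactors (e q).2) (σ q),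
      ← unitsMap_modNCyclotomicCharacter_of_dvd ℚ (dvd_of_eq (heN q)) (σ q), hσχ]
    exact forall_mem_zpowers_unitsMap_of_eq (heN q) (η q) (hη q q.2) y
  have hψe : ∀ q : r, Multiplicative.toAdd
      (ψ (((e q : (cycLevel p 0 r).primeFactors) : ℕ))
        (ZMod.unitsMap (Nat.dvd_of_mem_primeFactors (e q).2)
          (modNCyclotomicCharacter ℚ (cycLevel p 0 r) (σ q)))) = 1 := by
    intro q
    haveI := hne q
    rw [unitsMap_modNCyclotomicCharacter_of_dvd ℚ (Nat.dvd_of_mem_primeFactors (e q).2) (σ q),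
      ← unitsMap_modNCyclotomicCharacter_of_dvd ℚ (dvd_of_eq (heN q)) (σ q), hσχ]
    exact (hψ _ q q.2 (heN q)).2
  obtain ⟨hσψ', hord', hgen'⟩ := UnitsCRT.generator_hypotheses_of_equiv (cycLevel p 0 r) r e
    (fun q => modNCyclotomicCharacter ℚ (cycLevel p 0 r) (σ q)) hsf hoff hcyc ψ hψe
  -- ### PK-3 (Kim–Nakamura Prop. 3.5) at the level `n(r)`, reindexed by the places
  have hPK3 := MazurTateDerivative.mapRingHom_padicLift_mul_prod_deriv_eq_kuriharaNumber_smul f (k + 1)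
    hf hp2 hirr hKP ψ hΘ (fun ℓ => modNCyclotomicCharacter ℚ (cycLevel p 0 r) (σ (e.symm ℓ)))
    hσψ' hord' hgen'
  have hb : ∀ q : r, modNCyclotomicCharacter ℚ (cycLevel p 0 r) (σ q) =
      (fun ℓ : (cycLevel p 0 r).primeFactors =>
        modNCyclotomicCharacter ℚ (cycLevel p 0 r) (σ (e.symm ℓ))) (e q) := fun q => by
    simp only [Equiv.symm_apply_apply]
  have hN : ∀ q : r, ((primesEquiv (q : HeightOneSpectrum (𝓞 ℚ)) : Nat.Primes) : ℕ) - 1 =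
      (fun ℓ : (cycLevel p 0 r).primeFactors => (ℓ : ℕ) - 1) (e q) := fun q => by
    simp only [he q]
  rw [GroupRingEval.prod_sum_fin_single_pow_eq_of_equiv r e
      (fun ℓ : (cycLevel p 0 r).primeFactors =>
        modNCyclotomicCharacter ℚ (cycLevel p 0 r) (σ (e.symm ℓ))) (fun ℓ => (ℓ : ℕ) - 1)
      (fun q => modNCyclotomicCharacter ℚ (cycLevel p 0 r) (σ q))
      (fun q => ((primesEquiv q : Nat.Primes) : ℕ) - 1) (fun j => ((j : ℕ) : ZMod (p ^ (k + 1)))) hb hN,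
    GroupRingEval.prod_sum_fin_single_pow_eq_of_equiv r e
      (fun ℓ : (cycLevel p 0 r).primeFactors =>
        modNCyclotomicCharacter ℚ (cycLevel p 0 r) (σ (e.symm ℓ))) (fun ℓ => (ℓ : ℕ) - 1)
      (fun q => modNCyclotomicCharacter ℚ (cycLevel p 0 r) (σ q))
      (fun q => ((primesEquiv q : Nat.Primes) : ℕ) - 1) (fun _ => (1 : ZMod (p ^ (k + 1)))) hb hN] at hPK3
  -- `∏ Nrm = Σ_g δ_g` (T-PKEV E-A), reindexed
  have hnorm : ∏ q ∈ r, ∑ j : Fin (((primesEquiv q : Nat.Primes) : ℕ) - 1),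
      MonoidAlgebra.single (modNCyclotomicCharacter ℚ (cycLevel p 0 r) (σ q) ^ (j : ℕ)) (1 : ℤ_[p]) =
        ∑ g : (ZMod (cycLevel p 0 r))ˣ, MonoidAlgebra.single g 1 := by
    rw [← GroupRingEval.prod_sum_fin_single_pow_eq_of_equiv r e
      (fun ℓ : (cycLevel p 0 r).primeFactors =>
        modNCyclotomicCharacter ℚ (cycLevel p 0 r) (σ (e.symm ℓ))) (fun ℓ => (ℓ : ℕ) - 1)
      (fun q => modNCyclotomicCharacter ℚ (cycLevel p 0 r) (σ q))
      (fun q => ((primesEquiv q : Nat.Primes) : ℕ) - 1) (fun _ => (1 : ℤ_[p])) hb hN]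
    exact GroupRingEval.prod_norm_eq_sum_single _ _ hgen'
      (GroupRingEval.card_units_zmod_eq_prod_sub_one (cycLevel p 0 r) hsf)
  -- ### the twist by `V` (T-PK6-VAL FILE 1 ★): scalar `((−1)^ν δ̃) · aug V̄`, `aug V̄` a unit
  have hD := GroupRingEval.mapRingHom_mul_mul_prod_deriv_eq_smul p (cycLevel p 0 r) r
    (fun q => modNCyclotomicCharacter ℚ (cycLevel p 0 r) (σ q))
    (fun q => ((primesEquiv q : Nat.Primes) : ℕ) - 1) Θ₀ V (k + 1) _ hPK3 hnorm
  have hV' : IsUnit (∑ g : (ZMod (cycLevel p 0 r))ˣ,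
      (MonoidAlgebra.mapRingHom (ZMod (cycLevel p 0 r))ˣ (PadicInt.toZModPow (k + 1)) V).coeff g) := by
    simp_rw [MonoidAlgebra.coeff_mapRingHom]
    rw [← map_sum]
    exact hV.map _
  rw [← hV'.unit_spec] at hD
  -- ### the scalar `λ = n(r)` is a `p`-adic unit (T-PK6-VAL FILE 2)
  obtain ⟨u, hu⟩ := TameLevel.exists_units_coe_eq_cycLevel_zero p r hrp
  rw [← Rat.cast_natCast] at hu
  -- ### the comparison: membership ⟹ E-C's `hXY`; then T-PK6-VAL FILE 1 ★ (hval + unit reading)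
  obtain ⟨Wc, hXY⟩ := GroupRingEval.exists_comparison_of_mem_map_span p (cycLevel p 0 r) r
    (fun q => modNCyclotomicCharacter ℚ (cycLevel p 0 r) (σ q))
    (fun q => ((primesEquiv q : Nat.Primes) : ℕ) - 1) _ (Θ₀ * V) (k + 1) hmem
  obtain ⟨s, hval, w, hw⟩ := GroupRingEval.exists_witness_hval_and_toZModPow_eq p (cycLevel p 0 r) hsf
    r (fun q => modNCyclotomicCharacter ℚ (cycLevel p 0 r) (σ q))
    (fun q => ((primesEquiv q : Nat.Primes) : ℕ) - 1) xr X hxX _ u hu (Θ₀ * V) Wc k t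
    (kuriharaNumber f (p ^ (k + 1)) (cycLevel p 0 r) ψ) hV'.unit hXY hD hnorm
    (ZetaValue.pairwise_commute_fieldDeriv (cycLevel p 0 r)
      (fun ℓ => modNCyclotomicCharacter ℚ (cycLevel p 0 r) (σ ℓ))
      (fun ℓ => ((primesEquiv ℓ : Nat.Primes) : ℕ) - 1) r)
  -- ### packaging in PK-6₂'s currency (`ψ` onto at `N𝔮`; `kuriharaNumber` at `∏ N𝔮`)
  refine ⟨s, w, ψ, fun q hq => (hψ _ q hq rfl).1, hval, ?_⟩
  haveI : NeZero (∏ q ∈ r, Ideal.absNorm q.asIdeal) :=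
    ⟨Finset.prod_ne_zero_iff.2 fun q _ h => q.ne_bot (Ideal.absNorm_eq_zero_iff.1 h)⟩
  rw [hw, ← kuriharaNumber_congr f (p ^ (k + 1)) (cycLevel_zero_eq_prod_absNorm p r) ψ]

/-! ### §3 The `p`-integral structure `Θ₀` of the Mazur–Tate element at a Kolyvagin level exists -/

omit [Fact p.Prime] [W.IsElliptic] in
/-- **`gcd(n(r), N) = 1`** for a level `r` of Kolyvagin primes of `E` and the conductor `N` (Kolyvagin
primes do not divide the conductor, `Kato.IsKolyvaginPrime.not_dvd_conductorNorm`). [folklore] -/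
theorem coprime_cycLevel_zero_conductorNorm {k : ℕ} (r : Finset (HeightOneSpectrum (𝓞 ℚ)))
    (hKol : ∀ q ∈ r, Kato.IsKolyvaginPrime W p k ((primesEquiv q : Nat.Primes) : ℕ)) :
    Nat.Coprime (cycLevel p 0 r) (W.conductorNorm ℤ) := by
  rw [TameLevel.cycLevel_zero_eq_prod]
  exact Nat.Coprime.prod_left fun q hq =>
    (Nat.Prime.coprime_iff_not_dvd (primesEquiv q).2).2 (hKol q hq).not_dvd_conductorNorm

/-- **The `p`-integral structure `Θ₀ ∈ ℤ_p[(ℤ/n)ˣ]` of `θ̃_f(n(r))` EXISTS** (PK-3's / ★★'s binder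
`hΘ` discharged): `p` odd, `E[p]` irreducible, `f` the newform of `E` of level `N = ` conductor, `r` a
level of Kolyvagin primes — the symbols `[a/n]⁺_f` are `p`-integral
(`IsNewformOf.norm_ratPlusSymbol_div_le_one`, Stevens; Kim's standing hypothesis §1.4.1) and
`exists_padicLift_modularElement` assembles `Θ₀`.
[cite: Kim2022StructureSelmer, §1.4.1 (arXiv v3 p. 7)] [cite: Kurihara2014, §1.1 (PDF p. 2)] -/
theorem exists_padicLift_cycLevel_zero (hp2 : p ≠ 2) (hf : IsNewformOf W f)
    (hirr : W.HasIrreducibleModPGaloisRep p) (hN : N₀ = W.conductorNorm ℤ) {k : ℕ}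
    (r : Finset (HeightOneSpectrum (𝓞 ℚ)))
    (hKol : ∀ q ∈ r, Kato.IsKolyvaginPrime W p k ((primesEquiv q : Nat.Primes) : ℕ)) :
    ∃ Θ₀ : MonoidAlgebra ℤ_[p] (ZMod (cycLevel p 0 r))ˣ,
      ∀ a : (ZMod (cycLevel p 0 r))ˣ, ((Θ₀.coeff a : ℤ_[p]) : ℚ_[p]) =
        ((ratPlusSymbol f ((((a : ZMod (cycLevel p 0 r))).val : ℚ) / (cycLevel p 0 r)) : ℚ) : ℚ_[p]) := by
  have hcop : Nat.Coprime (cycLevel p 0 r) N₀ := by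
    rw [hN]; exact coprime_cycLevel_zero_conductorNorm p r hKol
  refine exists_padicLift_modularElement f p (cycLevel p 0 r) fun a => ?_
  have h := hf.norm_ratPlusSymbol_div_le_one hp2 hirr hcop ((a : ZMod (cycLevel p 0 r)).val : ℤ)
  rwa [Int.cast_natCast] at h

end Summit.BirchSwinnertonDyer.Rank1Residual.GaloisImage.ValueRow

end
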